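import Literature.NumberTheory.Sieve.SmoothSaddlePointPhi
import Literature.NumberTheory.Sieve.DickmanFunction
import Literature.NumberTheory.LFunctions.MertensSecondLogPower
import HarnessLib

/-!
# The saddle point and de Bruijn's `ξ(u)`: `(1 - α(x, y)) log y = ξ(u) + O(u/log y)`

Topic `Literature/NumberTheory/Sieve`; a PROVED tool file toward `Literature.NumberTheory.Sieve.HTLocalBehaviour`
(Hildebrand–Tenenbaum 1986, Theorem 3) in the range of small `u = log x/log y`. There Theorem 1 is deduced from
de Bruijn's `Ψ(x, y) = xρ(u)(1 + O(log(u+1)/log y))` and the comparison [HildebrandTenenbaum1986, Thm 2 (ii),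
(2.6)] of the saddle-point data with the Dickman data, whose germ is the relation between the saddle point
`α = α(x, y)` (`Σ_{p ≤ y} log p/(p^α - 1) = log x`) and de Bruijn's `ξ = ξ(u)` (`e^ξ = 1 + uξ`):

* `abs_sum_primesLE_log_mul_rpow_sub_le` — with the prime number theorem `θ(t) = t + O(t/log² t)`,
  `|Σ_{p ≤ y} log p · p^{-σ} - (y^{1-σ} - σ 2^{1-σ})/(1 - σ)| ≤ C (y^{1-σ}/log² y + ∫₂^y t^{-σ} dt/log² t)`
  (`0 < σ < 1`);
* `integral_rpow_neg_div_log_sq_le` — `∫₂^y t^{-σ}/log² t dt ≤ y^{(1-σ)/2}/log 2 + 4y^{1-σ}/((1-σ) log² y)`;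
* `exists_abs_one_sub_saddlePoint_mul_log_sub_dickmanXi_le` — **the theorem**: there are `C`, `y₀`, `u₀`
  with `|(1 - α(x, y)) log y - ξ(u)| ≤ C u/log y` whenever `y ≥ y₀`, `y ≤ x`, `u₀ ≤ u ≤ log y`
  (so that `s = (1 - α) log y` solves `(e^s - 1)/s = u + O(u/log y)`, and `g(s) = (e^s - 1)/s` has `g' ≥ 1/2`).

Only Chebyshev-type inputs and `θ(t) = t + O(t/log² t)` (`exists_abs_theta_sub_le_div_log_pow`, from the
tree's de la Vallée Poussin prime number theorem) are used.

## References

* [HildebrandTenenbaum1986] A. Hildebrand, G. Tenenbaum, Trans. AMS 296 (1986) 265–290, Thm 2 (ii) (2.6) and §7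
  (held: `paper:doi-10-1090-s0002-9947-1986-0837811-1`, pp. 268, 285–289).
* [MontgomeryVaughan2007] H. L. Montgomery, R. C. Vaughan, *Multiplicative Number Theory I*, §7.1.
-/

noncomputable section

open Real Filter Finset MeasureTheory Chebyshev

namespace Literature.NumberTheory.Sieve

variable {σ : ℝ} {y : ℕ}

/-! ### `∫ dt/(t log² t)` and `∫₂^y t^{-σ}/log² t dt` -/

/-- `∫ₐᵇ dt/(t log² t) = 1/log a - 1/log b` for `1 < a ≤ b`. [folklore] -/
theorem integral_inv_mul_log_sq {a b : ℝ} (ha : 1 < a) (hab : a ≤ b) :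
    ∫ t in a..b, 1 / (t * Real.log t ^ 2) = 1 / Real.log a - 1 / Real.log b := by
  have hderiv : ∀ t ∈ Set.uIcc a b, HasDerivAt (fun t => -(Real.log t)⁻¹) (1 / (t * Real.log t ^ 2)) t := by
    intro t ht
    rw [Set.uIcc_of_le hab] at ht
    have ht0 : 0 < t := by linarith [ht.1]
    have hlog : Real.log t ≠ 0 := (Real.log_pos (by linarith [ht.1])).ne'
    have h := ((Real.hasDerivAt_log ht0.ne').inv hlog).neg
    have h2 : 1 / (t * Real.log t ^ 2) = -(-t⁻¹ / Real.log t ^ 2) := by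
      rw [neg_div, neg_neg, inv_eq_one_div, div_div]
    rw [h2]
    exact h
  have hcont : ContinuousOn (fun t => 1 / (t * Real.log t ^ 2)) (Set.uIcc a b) := by
    rw [Set.uIcc_of_le hab]
    refine ContinuousOn.div continuousOn_const (continuousOn_id.mul ((continuousOn_log.mono ?_).pow 2)) ?_
    · intro t ht; exact ne_of_gt (by linarith [ht.1])
    · intro t ht
      have : 0 < Real.log t := Real.log_pos (by linarith [ht.1])
      have : 0 < t := by linarith [ht.1]
      positivity
  rw [intervalIntegral.integral_eq_sub_of_hasDerivAt hderiv (hcont.intervalIntegrable)]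
  simp only [one_div]
  ring

/-- `∫₂^y t^{-σ}/log² t dt ≤ y^{(1-σ)/2}/log 2 + 4 y^{1-σ}/((1-σ) log² y)` for `0 ≤ σ < 1`, `y ≥ 4`
(split at `√y`: below, `t^{1-σ} ≤ y^{(1-σ)/2}` and `∫ dt/(t log² t) ≤ 1/log 2`; above, `log t ≥ (log y)/2`).
[folklore] -/
theorem integral_rpow_neg_div_log_sq_le (hσ : σ < 1) (hy : 4 ≤ y) :
    ∫ t in (2 : ℝ)..y, (t : ℝ) ^ (-σ) / Real.log t ^ 2 ≤
      (y : ℝ) ^ ((1 - σ) / 2) / Real.log 2 + 4 * (y : ℝ) ^ (1 - σ) / ((1 - σ) * Real.log y ^ 2) := by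
  have hy4 : (4 : ℝ) ≤ y := by exact_mod_cast hy
  have hy0 : (0 : ℝ) < y := by linarith
  have hy2 : 2 ≤ y := le_trans (by norm_num) hy
  set m : ℝ := Real.sqrt y with hm
  have hm2 : 2 ≤ m := by
    rw [hm, show (2 : ℝ) = Real.sqrt 4 by rw [show (4 : ℝ) = 2 ^ 2 by norm_num, Real.sqrt_sq (by norm_num)]]
    exact Real.sqrt_le_sqrt hy4
  have hmy : m ≤ y := by
    rw [hm, Real.sqrt_le_left hy0.le]; nlinarith
  have hmsq : m ^ 2 = y := by rw [hm, Real.sq_sqrt hy0.le]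
  have hlogm : Real.log m = Real.log y / 2 := by
    rw [hm, Real.log_sqrt hy0.le]
  have hL : 0 < Real.log y := Real.log_pos (by linarith)
  -- continuity / integrability of the integrand on `[2, y]`
  have hcont : ∀ a b : ℝ, 2 ≤ a → a ≤ b →
      IntervalIntegrable (fun t : ℝ => t ^ (-σ) / Real.log t ^ 2) volume a b := by
    intro a b ha hab
    refine ContinuousOn.intervalIntegrable ?_
    rw [Set.uIcc_of_le hab]
    refine ContinuousOn.div (ContinuousOn.rpow_const continuousOn_id fun t ht => Or.inl ?_)
      ((continuousOn_log.mono ?_).pow 2) ?_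
    · exact ne_of_gt (by linarith [ht.1])
    · intro t ht; exact ne_of_gt (by linarith [ht.1])
    · intro t ht; exact pow_ne_zero 2 (Real.log_pos (by linarith [ht.1])).ne'
  rw [← intervalIntegral.integral_add_adjacent_intervals (hcont 2 m le_rfl hm2) (hcont m y hm2 hmy)]
  -- below `√y`
  have hA : ∫ t in (2 : ℝ)..m, t ^ (-σ) / Real.log t ^ 2 ≤ (y : ℝ) ^ ((1 - σ) / 2) / Real.log 2 := by
    have hmpow : m ^ (1 - σ) = (y : ℝ) ^ ((1 - σ) / 2) := by
      rw [hm, Real.sqrt_eq_rpow, ← Real.rpow_mul hy0.le]; ring_nf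
    have h1 : ∫ t in (2 : ℝ)..m, t ^ (-σ) / Real.log t ^ 2 ≤ ∫ t in (2 : ℝ)..m, m ^ (1 - σ) * (1 / (t * Real.log t ^ 2)) := by
      refine intervalIntegral.integral_mono_on hm2 (hcont 2 m le_rfl hm2) ?_ fun t ht => ?_
      · refine ContinuousOn.intervalIntegrable ?_
        rw [Set.uIcc_of_le hm2]
        refine ContinuousOn.mul continuousOn_const (ContinuousOn.div continuousOn_const
          (continuousOn_id.mul ((continuousOn_log.mono ?_).pow 2)) ?_)
        · intro t ht; exact ne_of_gt (by linarith [ht.1])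
        · intro t ht
          have : 0 < Real.log t := Real.log_pos (by linarith [ht.1])
          have : 0 < t := by linarith [ht.1]
          positivity
      · have ht0 : 0 < t := by linarith [ht.1]
        have hlog : 0 < Real.log t := Real.log_pos (by linarith [ht.1])
        have hsplit : t ^ (-σ) = t ^ (1 - σ) * t⁻¹ := by
          rw [← Real.rpow_neg_one, ← Real.rpow_add ht0]; ring_nf
        rw [hsplit, div_eq_mul_one_div, mul_assoc, show t⁻¹ * (1 / Real.log t ^ 2) = 1 / (t * Real.log t ^ 2) by
          field_simp]
        refine mul_le_mul_of_nonneg_right (Real.rpow_le_rpow ht0.le ht.2 (by linarith)) (by positivity)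
    rw [intervalIntegral.integral_const_mul, integral_inv_mul_log_sq one_lt_two hm2, hmpow] at h1
    refine h1.trans ?_
    have hlm : 0 < Real.log m := Real.log_pos (by linarith)
    have hlm' : 0 ≤ 1 / Real.log m := by positivity
    have h3 : 1 / Real.log 2 - 1 / Real.log m ≤ 1 / Real.log 2 := by linarith
    calc (y : ℝ) ^ ((1 - σ) / 2) * (1 / Real.log 2 - 1 / Real.log m) ≤ (y : ℝ) ^ ((1 - σ) / 2) * (1 / Real.log 2) :=
          mul_le_mul_of_nonneg_left h3 (by positivity)
      _ = (y : ℝ) ^ ((1 - σ) / 2) / Real.log 2 := by ring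
  -- above `√y`
  have hB : ∫ t in m..(y : ℝ), t ^ (-σ) / Real.log t ^ 2 ≤ 4 * (y : ℝ) ^ (1 - σ) / ((1 - σ) * Real.log y ^ 2) := by
    have h1 : ∫ t in m..(y : ℝ), t ^ (-σ) / Real.log t ^ 2 ≤ ∫ t in m..(y : ℝ), 4 / Real.log y ^ 2 * t ^ (-σ) := by
      refine intervalIntegral.integral_mono_on hmy (hcont m y hm2 hmy) ?_ fun t ht => ?_
      · exact (ContinuousOn.rpow_const continuousOn_id fun t ht => Or.inl (ne_of_gt (show (0 : ℝ) < t by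
          rw [Set.uIcc_of_le hmy] at ht; linarith [ht.1]))).intervalIntegrable.const_mul _
      · have ht0 : 0 < t := by linarith [ht.1]
        have hlogt : Real.log y / 2 ≤ Real.log t := by rw [← hlogm]; exact Real.log_le_log (by linarith) ht.1
        have hlogt0 : 0 < Real.log t := by linarith
        rw [div_le_iff₀ (by positivity)]
        have hp : 0 ≤ t ^ (-σ) := Real.rpow_nonneg ht0.le _
        have : Real.log y ^ 2 ≤ 4 * Real.log t ^ 2 := by nlinarith
        calc t ^ (-σ) = t ^ (-σ) * Real.log y ^ 2 / Real.log y ^ 2 := by field_simp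
          _ ≤ t ^ (-σ) * (4 * Real.log t ^ 2) / Real.log y ^ 2 := by gcongr
          _ = 4 / Real.log y ^ 2 * t ^ (-σ) * Real.log t ^ 2 := by ring
    refine h1.trans ?_
    rw [intervalIntegral.integral_const_mul]
    have h2 : ∫ t in m..(y : ℝ), t ^ (-σ) ≤ (y : ℝ) ^ (1 - σ) / (1 - σ) := by
      have hsplit := intervalIntegral.integral_add_adjacent_intervals (μ := volume) (a := (2 : ℝ)) (b := m)
        (c := (y : ℝ)) (f := fun t : ℝ => t ^ (-σ)) ?_ ?_
      · have h3 : 0 ≤ ∫ t in (2 : ℝ)..m, t ^ (-σ) :=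
          intervalIntegral.integral_nonneg hm2 fun t ht => Real.rpow_nonneg (by linarith [ht.1]) _
        have h4 := integral_rpow_neg_le_of_lt_one hσ hy2
        linarith
      all_goals exact (ContinuousOn.rpow_const continuousOn_id fun t ht => Or.inl (ne_of_gt (show (0 : ℝ) < t by
          rcases Set.mem_uIcc.1 ht with h | h <;> linarith [h.1]))).intervalIntegrable
    calc 4 / Real.log y ^ 2 * ∫ t in m..(y : ℝ), t ^ (-σ) ≤ 4 / Real.log y ^ 2 * ((y : ℝ) ^ (1 - σ) / (1 - σ)) :=
          mul_le_mul_of_nonneg_left h2 (by positivity)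
      _ = 4 * (y : ℝ) ^ (1 - σ) / ((1 - σ) * Real.log y ^ 2) := by
          field_simp
  linarith

/-! ### `Σ_{p ≤ y} log p · p^{-σ}` by the prime number theorem -/

/-- **`Σ_{p ≤ y} log p · p^{-σ} = (y^{1-σ} - σ2^{1-σ})/(1-σ) + O(y^{1-σ}/log² y + ∫₂^y t^{-σ} dt/log² t)`**
for `0 < σ < 1`, from Abel summation and `θ(t) = t + O(t/log² t)`. [cite: HildebrandTenenbaum1986, §7 (7.4)] -/
theorem abs_sum_primesLE_log_mul_rpow_sub_le :
    ∃ C : ℝ, 0 ≤ C ∧ ∀ (σ : ℝ) (y : ℕ), 0 < σ → σ < 1 → 2 ≤ y →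
      |∑ p ∈ Nat.primesLE y, Real.log p * (p : ℝ) ^ (-σ) -
          ((y : ℝ) ^ (1 - σ) - σ * (2 : ℝ) ^ (1 - σ)) / (1 - σ)| ≤
        C * ((y : ℝ) ^ (1 - σ) / Real.log y ^ 2 + ∫ t in (2 : ℝ)..y, (t : ℝ) ^ (-σ) / Real.log t ^ 2) := by
  obtain ⟨C, hC0, hθ⟩ := LFunctions.Mertens.exists_abs_theta_sub_le_div_log_pow 2
  refine ⟨C, hC0, fun σ y hσ0 hσ1 hy => ?_⟩
  have hy2 : (2 : ℝ) ≤ y := by exact_mod_cast hy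
  have hy0 : (0 : ℝ) < y := by linarith
  have hβ : 0 < 1 - σ := by linarith
  rw [sum_primesLE_log_mul_rpow_eq σ hy]
  -- split `θ = id + E` inside the integral
  have hint_t : IntervalIntegrable (fun t : ℝ => t ^ (-σ)) volume 2 y :=
    (ContinuousOn.rpow_const continuousOn_id fun t ht => Or.inl (ne_of_gt (show (0 : ℝ) < t by
      rcases Set.mem_uIcc.1 ht with h | h <;> linarith [h.1]))).intervalIntegrable
  have hint_θ : IntervalIntegrable (fun t : ℝ => θ t * t ^ (-σ - 1)) volume 2 y :=
    intervalIntegrable_theta_mul_rpow _ two_pos hy0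
  have hint_id : IntervalIntegrable (fun t : ℝ => t * t ^ (-σ - 1)) volume 2 y := by
    refine (intervalIntegrable_iff.2 ?_)
    have := hint_t
    rw [intervalIntegrable_iff] at this
    refine this.congr_fun (fun t ht => ?_) measurableSet_uIoc
    have ht0 : 0 < t := by
      rw [Set.uIoc_of_le hy2] at ht; linarith [ht.1]
    show t ^ (-σ) = t * t ^ (-σ - 1)
    rw [show t * t ^ (-σ - 1) = t ^ (1 : ℝ) * t ^ (-σ - 1) by rw [Real.rpow_one], ← Real.rpow_add ht0]
    ring_nf
  have hsplit : ∫ t in (2 : ℝ)..y, θ t * t ^ (-σ - 1) =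
      (∫ t in (2 : ℝ)..y, t ^ (-σ)) + ∫ t in (2 : ℝ)..y, (θ t - t) * t ^ (-σ - 1) := by
    have h1 : ∫ t in (2 : ℝ)..y, t ^ (-σ) = ∫ t in (2 : ℝ)..y, t * t ^ (-σ - 1) := by
      refine intervalIntegral.integral_congr fun t ht => ?_
      have ht0 : 0 < t := by rw [Set.uIcc_of_le hy2] at ht; linarith [ht.1]
      show t ^ (-σ) = t * t ^ (-σ - 1)
      rw [show t * t ^ (-σ - 1) = t ^ (1 : ℝ) * t ^ (-σ - 1) by rw [Real.rpow_one], ← Real.rpow_add ht0]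
      ring_nf
    have hint_E : IntervalIntegrable (fun t : ℝ => (θ t - t) * t ^ (-σ - 1)) volume 2 y := by
      have := hint_θ.sub hint_id
      have hfg : (fun t : ℝ => θ t * t ^ (-σ - 1) - t * t ^ (-σ - 1)) = fun t => (θ t - t) * t ^ (-σ - 1) := by
        funext t; ring
      rwa [hfg] at this
    rw [h1, ← intervalIntegral.integral_add hint_id hint_E]
    refine intervalIntegral.integral_congr fun t _ => ?_
    ring
  -- the error integral
  have hR : |∫ t in (2 : ℝ)..y, (θ t - t) * t ^ (-σ - 1)| ≤ C * ∫ t in (2 : ℝ)..y, (t : ℝ) ^ (-σ) / Real.log t ^ 2 := by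
    rw [← intervalIntegral.integral_const_mul, ← Real.norm_eq_abs]
    refine intervalIntegral.norm_integral_le_of_norm_le hy2 (Filter.Eventually.of_forall fun t ht => ?_) ?_
    · have ht2 : 2 ≤ t := ht.1.le
      have ht0 : 0 < t := by linarith
      have hlog : 0 < Real.log t := Real.log_pos (by linarith)
      rw [Real.norm_eq_abs, abs_mul, abs_of_nonneg (Real.rpow_nonneg ht0.le _)]
      have h1 := hθ t ht2
      calc |θ t - t| * t ^ (-σ - 1) ≤ C * t / Real.log t ^ 2 * t ^ (-σ - 1) :=
            mul_le_mul_of_nonneg_right h1 (Real.rpow_nonneg ht0.le _)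
        _ = C * (t ^ (-σ) / Real.log t ^ 2) := by
            rw [show t ^ (-σ) = t ^ (1 : ℝ) * t ^ (-σ - 1) by rw [← Real.rpow_add ht0]; ring_nf, Real.rpow_one]
            field_simp
    · refine IntervalIntegrable.const_mul ?_ C
      refine ContinuousOn.intervalIntegrable ?_
      rw [Set.uIcc_of_le hy2]
      refine ContinuousOn.div (ContinuousOn.rpow_const continuousOn_id fun t ht => Or.inl ?_)
        ((continuousOn_log.mono ?_).pow 2) ?_
      · exact ne_of_gt (by linarith [ht.1])
      · intro t ht; exact ne_of_gt (by linarith [ht.1])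
      · intro t ht; exact pow_ne_zero 2 (Real.log_pos (by linarith [ht.1])).ne'
  -- `θ(y) = y + E(y)`
  have hEy := hθ y hy2
  have hlogy : 0 < Real.log y := Real.log_pos (by linarith)
  -- assemble: `T - main = E(y) y^{-σ} + σ ∫ E t^{-σ-1}`
  rw [hsplit, integral_rpow_neg_eq hσ1.ne hy]
  have hkey : θ y * (y : ℝ) ^ (-σ) + σ * (((y : ℝ) ^ (1 - σ) - (2 : ℝ) ^ (1 - σ)) / (1 - σ) +
      ∫ t in (2 : ℝ)..y, (θ t - t) * t ^ (-σ - 1)) - ((y : ℝ) ^ (1 - σ) - σ * (2 : ℝ) ^ (1 - σ)) / (1 - σ) =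
      (θ y - y) * (y : ℝ) ^ (-σ) + σ * ∫ t in (2 : ℝ)..y, (θ t - t) * t ^ (-σ - 1) := by
    have hyy : (y : ℝ) * (y : ℝ) ^ (-σ) = (y : ℝ) ^ (1 - σ) := by
      rw [show (y : ℝ) * (y : ℝ) ^ (-σ) = (y : ℝ) ^ (1 : ℝ) * (y : ℝ) ^ (-σ) by rw [Real.rpow_one],
        ← Real.rpow_add hy0]; ring_nf
    field_simp
    nlinarith [hyy]
  rw [hkey]
  refine (abs_add_le _ _).trans ?_
  rw [abs_mul, abs_mul, abs_of_nonneg (Real.rpow_nonneg hy0.le _), abs_of_nonneg hσ0.le, mul_add]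
  refine add_le_add ?_ ?_
  · calc |θ y - y| * (y : ℝ) ^ (-σ) ≤ C * y / Real.log y ^ 2 * (y : ℝ) ^ (-σ) :=
          mul_le_mul_of_nonneg_right hEy (Real.rpow_nonneg hy0.le _)
      _ = C * ((y : ℝ) ^ (1 - σ) / Real.log y ^ 2) := by
          rw [show (y : ℝ) ^ (1 - σ) = (y : ℝ) ^ (1 : ℝ) * (y : ℝ) ^ (-σ) by rw [← Real.rpow_add hy0]; ring_nf,
            Real.rpow_one]
          field_simp
  · calc σ * |∫ t in (2 : ℝ)..y, (θ t - t) * t ^ (-σ - 1)| ≤ 1 * (C * ∫ t in (2 : ℝ)..y, t ^ (-σ) / Real.log t ^ 2) :=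
          mul_le_mul hσ1.le hR (abs_nonneg _) zero_le_one
      _ = C * ∫ t in (2 : ℝ)..y, t ^ (-σ) / Real.log t ^ 2 := one_mul _

/-! ### The theorem -/

/-- `|1 - (1-β)2^β| ≤ 4β` for `0 ≤ β ≤ 1` (`2^β - 1 ≤ β 2^β log 2`). [folklore] -/
theorem abs_one_sub_mul_two_rpow_le {β : ℝ} (hβ0 : 0 ≤ β) (hβ1 : β ≤ 1) : |1 - (1 - β) * (2 : ℝ) ^ β| ≤ 4 * β := by
  have h2β : (2 : ℝ) ^ β ≤ 2 := by
    calc (2 : ℝ) ^ β ≤ (2 : ℝ) ^ (1 : ℝ) := Real.rpow_le_rpow_of_exponent_le one_le_two hβ1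
      _ = 2 := Real.rpow_one 2
  have h2β0 : 0 < (2 : ℝ) ^ β := by positivity
  have hl2 : Real.log 2 ≤ 1 := by
    have := Real.log_le_sub_one_of_pos (show (0 : ℝ) < 2 by norm_num); linarith
  have hl20 : 0 < Real.log 2 := Real.log_pos one_lt_two
  -- `2^β - 1 ≤ β log 2 · 2^β`, from `1 - a ≤ e^{-a}` with `a = β log 2`
  have hkey : (2 : ℝ) ^ β - 1 ≤ β * Real.log 2 * (2 : ℝ) ^ β := by
    have ha := Real.add_one_le_exp (-(β * Real.log 2))
    have hexp : Real.exp (-(β * Real.log 2)) * (2 : ℝ) ^ β = 1 := by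
      rw [Real.rpow_def_of_pos two_pos, ← Real.exp_add]; simp [mul_comm]
    nlinarith [mul_le_mul_of_nonneg_right ha h2β0.le]
  have hge : 1 ≤ (2 : ℝ) ^ β := Real.one_le_rpow one_le_two hβ0
  rw [abs_le]
  constructor
  · nlinarith [mul_nonneg hβ0 h2β0.le]
  · nlinarith [mul_nonneg hβ0 h2β0.le, mul_le_mul_of_nonneg_left h2β hβ0, mul_nonneg (mul_nonneg hβ0 hl20.le) h2β0.le]

set_option maxHeartbeats 1600000 in
/-- **`(1 - α(x, y)) log y = ξ(u) + O(u/log y)`.** There are `C`, `y₀`, `u₀ > 1` such that for all real `x`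
and natural `y` with `y ≥ y₀`, `y ≤ x` and `u₀ log y ≤ log x ≤ (log y)²` (`u = log x/log y`):
`|(1 - α) log y - ξ(u)| ≤ C u/log y`, where `α = α(x, y)` is the saddle point and `e^{ξ(u)} = 1 + uξ(u)`.
(The saddle-point equation reads `(e^s - 1)/s = u + O(u/log y)` for `s = (1 - α) log y`, by
`abs_sum_primesLE_log_mul_rpow_sub_le`, and `g(s) = (e^s-1)/s` has `g' ≥ 1/2`.)
[cite: HildebrandTenenbaum1986, Thm 2 (ii) (2.6) and §7 (7.4)–(7.6)] -/
theorem exists_abs_one_sub_saddlePoint_mul_log_sub_dickmanXi_le :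
    ∃ C : ℝ, ∃ y₀ : ℕ, ∃ u₀ : ℝ, 1 < u₀ ∧ ∀ (x : ℝ) (y : ℕ), y₀ ≤ y → (y : ℝ) ≤ x →
      u₀ * Real.log y ≤ Real.log x → Real.log x ≤ Real.log y ^ 2 →
      |(1 - saddlePoint x y) * Real.log y - dickmanXi (Real.log x / Real.log y)| ≤
        C * (Real.log x / Real.log y) / Real.log y := by
  obtain ⟨x35, h35⟩ := three_fifths_le_saddlePoint
  obtain ⟨C₀, x₁, hC₀, hup⟩ := rpow_one_sub_saddlePoint_le
  obtain ⟨c₀, x₂, hc₀, hlo⟩ := le_rpow_one_sub_saddlePoint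
  obtain ⟨CT, hCT0, hT⟩ := abs_sum_primesLE_log_mul_rpow_sub_le
  -- `(log y)^6 ≤ y` eventually
  have hev : ∀ᶠ t : ℝ in atTop, Real.log t ^ 6 ≤ t := by
    have h := (isLittleO_log_rpow_rpow_atTop 6 (show (0 : ℝ) < 1 by norm_num)).bound (show (0 : ℝ) < 1 by norm_num)
    filter_upwards [h, eventually_ge_atTop 1] with t ht ht1
    have hl0 : 0 ≤ Real.log t := Real.log_nonneg ht1
    rw [Real.rpow_one, one_mul, Real.norm_of_nonneg (Real.rpow_nonneg hl0 _), Real.norm_of_nonneg (by linarith)] at ht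
    have : Real.log t ^ (6 : ℝ) = Real.log t ^ 6 := by norm_cast
    rw [this] at ht; exact ht
  obtain ⟨Y, hY⟩ := Filter.eventually_atTop.1 hev
  set K : ℝ := 34 + CT * (C₀ + Real.sqrt C₀ / Real.log 2 + 2 * C₀) with hK
  refine ⟨2 * K, max (max (max ⌈x35⌉₊ ⌈x₁⌉₊) (max ⌈x₂⌉₊ ⌈Y⌉₊)) ⌈Real.exp 4⌉₊, max 2 (Real.exp 2 / c₀),
    lt_of_lt_of_le one_lt_two (le_max_left _ _), fun x y hy hyx hu₀ huL => ?_⟩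
  -- thresholds
  have hceil : ∀ {z : ℝ} {n : ℕ}, ⌈z⌉₊ ≤ n → z ≤ n := fun h => le_trans (Nat.le_ceil _) (by exact_mod_cast h)
  have hyA : max (max ⌈x35⌉₊ ⌈x₁⌉₊) (max ⌈x₂⌉₊ ⌈Y⌉₊) ≤ y := le_trans (le_max_left _ _) hy
  have hx35y : x35 ≤ y := hceil (le_trans (le_max_left _ _) (le_trans (le_max_left _ _) hyA))
  have hx₁y : x₁ ≤ y := hceil (le_trans (le_max_right _ _) (le_trans (le_max_left _ _) hyA))
  have hx₂y : x₂ ≤ y := hceil (le_trans (le_max_left _ _) (le_trans (le_max_right _ _) hyA))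
  have hYy : Y ≤ y := hceil (le_trans (le_max_right _ _) (le_trans (le_max_right _ _) hyA))
  have hye4 : Real.exp 4 ≤ y := hceil (le_trans (le_max_right _ _) hy)
  have he4 : (4 : ℝ) + 1 ≤ Real.exp 4 := Real.add_one_le_exp 4
  have hy4r : (4 : ℝ) ≤ y := by linarith
  have hy4 : 4 ≤ y := by exact_mod_cast hy4r
  have hy2 : 2 ≤ y := le_trans (by norm_num) hy4
  have hy0 : (0 : ℝ) < y := by linarith
  have hy1 : (1 : ℝ) < y := by linarith
  set L : ℝ := Real.log y with hL
  have hL4 : 4 ≤ L := by have := Real.log_le_log (Real.exp_pos 4) hye4; rwa [Real.log_exp] at this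
  have hL0 : 0 < L := by linarith
  have hx1 : 1 < x := lt_of_lt_of_le hy1 hyx
  have hx0 : 0 < x := by linarith
  set u : ℝ := Real.log x / L with hudef
  have huL' : u * L = Real.log x := by rw [hudef]; field_simp
  have hu2 : 2 ≤ u := by
    have h1 : 2 * L ≤ Real.log x := le_trans (mul_le_mul_of_nonneg_right (le_max_left _ _) hL0.le) hu₀
    rw [hudef, le_div_iff₀ hL0]; exact h1
  have huc₀ : Real.exp 2 / c₀ ≤ u := by
    have h1 : Real.exp 2 / c₀ * L ≤ Real.log x := le_trans (mul_le_mul_of_nonneg_right (le_max_right _ _) hL0.le) hu₀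
    rw [hudef, le_div_iff₀ hL0]; exact h1
  have hu1 : 1 < u := by linarith
  have hu0 : 0 < u := by linarith
  have hule : u ≤ L := by
    rw [hudef, div_le_iff₀ hL0]; nlinarith
  -- the polylogarithmic range `(log x)^3 ≤ y`
  have hxy3 : Real.log x ^ 3 ≤ y := by
    have h1 : Real.log x ^ 3 ≤ (L ^ 2) ^ 3 := pow_le_pow_left₀ (Real.log_pos hx1).le huL 3
    have h2 : (L ^ 2) ^ 3 = L ^ 6 := by ring
    have h3 : L ^ 6 ≤ y := hY y hYy
    linarith
  have hxx : ∀ z : ℝ, z ≤ y → z ≤ x := fun z hz => hz.trans hyx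
  -- saddle-point data
  set α : ℝ := saddlePoint x y with hα
  have hα35 : 3 / 5 ≤ α := h35 x y (hxx _ hx35y) hxy3 hyx
  have hα0 : 0 < α := by linarith
  set β : ℝ := 1 - α with hβ
  have hyβup : (y : ℝ) ^ β ≤ C₀ * u ^ 2 := by
    have h1 := hup x y (hxx _ hx₁y) hxy3 hyx
    rw [← hudef] at h1
    have hlog : Real.log (u + 1) ≤ u := (Real.log_le_sub_one_of_pos (by linarith)).trans (by linarith)
    calc (y : ℝ) ^ β ≤ C₀ * (u * Real.log (u + 1)) := h1
      _ ≤ C₀ * (u * u) := by gcongr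
      _ = C₀ * u ^ 2 := by ring
  have hyβlo : Real.exp 2 ≤ (y : ℝ) ^ β := by
    have h1 := hlo x y (hxx _ hx₂y) hxy3 hyx
    rw [← hudef] at h1
    have hlog : 1 ≤ Real.log (u + 1) := by
      rw [Real.le_log_iff_exp_le (by linarith)]; have := Real.exp_one_lt_d9; linarith
    have h2 : c₀ * u ≤ c₀ * (u * Real.log (u + 1)) := by
      apply mul_le_mul_of_nonneg_left _ hc₀.le; nlinarith
    have h3 : Real.exp 2 ≤ c₀ * u := by rwa [div_le_iff₀ hc₀, mul_comm] at huc₀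
    linarith
  have hβ0 : 0 < β := by
    by_contra h
    push Not at h
    have : (y : ℝ) ^ β ≤ 1 := Real.rpow_le_one_of_one_le_of_nonpos hy1.le h
    have : (1 : ℝ) + 2 ≤ Real.exp 2 := by have := Real.add_one_le_exp (2 : ℝ); linarith
    linarith
  have hα1 : α < 1 := by linarith
  have hβ25 : β ≤ 2 / 5 := by linarith
  set s : ℝ := β * L with hs
  have hexps : Real.exp s = (y : ℝ) ^ β := by rw [hs, Real.rpow_def_of_pos hy0, mul_comm]
  have hs2 : 2 ≤ s := by
    have := hyβlo; rw [← hexps, Real.exp_le_exp] at this; exact this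
  have hs0 : 0 < s := by linarith
  have hsL : s = (1 - α) * L := by rw [hs]
  -- `e^s ≤ C₀ u²`, `e^{s/2} ≤ √C₀ u`
  have hes : Real.exp s ≤ C₀ * u ^ 2 := by rw [hexps]; exact hyβup
  have hes2 : Real.exp (s / 2) ≤ Real.sqrt C₀ * u := by
    have h1 : Real.exp (s / 2) = Real.sqrt (Real.exp s) := by
      rw [Real.sqrt_eq_rpow, ← Real.exp_mul]; ring_nf
    rw [h1, show Real.sqrt C₀ * u = Real.sqrt (C₀ * u ^ 2) by rw [Real.sqrt_mul hC₀.le, Real.sqrt_sq hu0.le]]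
    exact Real.sqrt_le_sqrt hes
  -- the saddle-point equation and the prime number theorem
  have hsaddle : saddleSum α y = u * L := by rw [huL']; exact saddleSum_saddlePoint hx1 hy2
  have hT1 : ∑ p ∈ Nat.primesLE y, Real.log p * (p : ℝ) ^ (-α) ≤ u * L := by
    rw [← hsaddle]; exact sum_primesLE_log_mul_rpow_le_saddleSum hα0 y
  have hT2 : u * L ≤ ∑ p ∈ Nat.primesLE y, Real.log p * (p : ℝ) ^ (-α) + 30 := by
    rw [← hsaddle]; exact saddleSum_le_sum_primesLE_log_mul_rpow_add hα35 hy2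
  have hT3 := hT α y hα0 hα1 hy2
  have hJ := integral_rpow_neg_div_log_sq_le (σ := α) hα1 hy4
  rw [← hβ] at hT3 hJ
  -- `M - L g(s) = (1 - α 2^β)/β`, `|…| ≤ 4`
  have hg : expSubOneDiv s = (Real.exp s - 1) / s := expSubOneDiv_of_ne_zero hs0.ne'
  have hM : ((y : ℝ) ^ β - α * (2 : ℝ) ^ β) / β - L * expSubOneDiv s = (1 - (1 - β) * (2 : ℝ) ^ β) / β := by
    rw [hg, ← hexps, hs, show α = 1 - β by rw [hβ]; ring]
    field_simp
    ring
  have hM4 : |((y : ℝ) ^ β - α * (2 : ℝ) ^ β) / β - L * expSubOneDiv s| ≤ 4 := by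
    rw [hM, abs_div, abs_of_pos hβ0, div_le_iff₀ hβ0]
    exact abs_one_sub_mul_two_rpow_le hβ0.le (by linarith)
  -- `|uL - L g(s)| ≤ 34 + CT (e^s/L² + e^{s/2}/log 2 + 4 e^s/(s L))`
  have hβL : β * L ^ 2 = s * L := by rw [hs]; ring
  have hmain : |u * L - L * expSubOneDiv s| ≤ 34 + CT * (Real.exp s / L ^ 2 + (Real.exp (s / 2) / Real.log 2 +
      4 * Real.exp s / (s * L))) := by
    have h1 : |u * L - ∑ p ∈ Nat.primesLE y, Real.log p * (p : ℝ) ^ (-α)| ≤ 30 := by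
      rw [abs_le]; constructor <;> linarith
    have h2 : |∑ p ∈ Nat.primesLE y, Real.log p * (p : ℝ) ^ (-α) - ((y : ℝ) ^ β - α * (2 : ℝ) ^ β) / β| ≤
        CT * (Real.exp s / L ^ 2 + (Real.exp (s / 2) / Real.log 2 + 4 * Real.exp s / (s * L))) := by
      refine hT3.trans (mul_le_mul_of_nonneg_left ?_ hCT0)
      rw [← hexps]
      refine add_le_add le_rfl (hJ.trans ?_)
      rw [show (y : ℝ) ^ (β / 2) = Real.exp (s / 2) by rw [Real.rpow_def_of_pos hy0, hs, hL]; ring_nf, hβL, hexps]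
    calc |u * L - L * expSubOneDiv s|
        = |(u * L - ∑ p ∈ Nat.primesLE y, Real.log p * (p : ℝ) ^ (-α)) +
            (∑ p ∈ Nat.primesLE y, Real.log p * (p : ℝ) ^ (-α) - ((y : ℝ) ^ β - α * (2 : ℝ) ^ β) / β) +
            (((y : ℝ) ^ β - α * (2 : ℝ) ^ β) / β - L * expSubOneDiv s)| := by ring_nf
      _ ≤ |u * L - ∑ p ∈ Nat.primesLE y, Real.log p * (p : ℝ) ^ (-α)| +
            |∑ p ∈ Nat.primesLE y, Real.log p * (p : ℝ) ^ (-α) - ((y : ℝ) ^ β - α * (2 : ℝ) ^ β) / β| +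
            |((y : ℝ) ^ β - α * (2 : ℝ) ^ β) / β - L * expSubOneDiv s| :=
          (abs_add_le _ _).trans (add_le_add (abs_add_le _ _) le_rfl)
      _ ≤ 30 + CT * (Real.exp s / L ^ 2 + (Real.exp (s / 2) / Real.log 2 + 4 * Real.exp s / (s * L))) + 4 := by
          linarith
      _ = _ := by ring
  -- the bracket is `≤ (C₀ + √C₀/log 2 + 2C₀) u`, hence `|u - g(s)| ≤ K u/L`
  have hl20 : 0 < Real.log 2 := Real.log_pos one_lt_two
  have hbr : Real.exp s / L ^ 2 + (Real.exp (s / 2) / Real.log 2 + 4 * Real.exp s / (s * L)) ≤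
      (C₀ + Real.sqrt C₀ / Real.log 2 + 2 * C₀) * u := by
    have k1 : Real.exp s / L ^ 2 ≤ C₀ * u := by
      rw [div_le_iff₀ (by positivity)]
      calc Real.exp s ≤ C₀ * u ^ 2 := hes
        _ = C₀ * u * u := by ring
        _ ≤ C₀ * u * L ^ 2 := by
            refine mul_le_mul_of_nonneg_left ?_ (by positivity)
            nlinarith
    have k2 : Real.exp (s / 2) / Real.log 2 ≤ Real.sqrt C₀ / Real.log 2 * u := by
      rw [div_mul_eq_mul_div]; exact div_le_div_of_nonneg_right hes2 hl20.le
    have k3 : 4 * Real.exp s / (s * L) ≤ 2 * C₀ * u := by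
      rw [div_le_iff₀ (by positivity)]
      calc 4 * Real.exp s ≤ 4 * (C₀ * u ^ 2) := by linarith
        _ = 2 * C₀ * u * (2 * u) := by ring
        _ ≤ 2 * C₀ * u * (s * L) := by
            refine mul_le_mul_of_nonneg_left ?_ (by positivity)
            nlinarith
    linarith
  have hug : |u - expSubOneDiv s| ≤ K * u / L := by
    have h1 : |u - expSubOneDiv s| * L = |u * L - L * expSubOneDiv s| := by
      rw [← abs_of_pos hL0, ← abs_mul, abs_of_pos hL0]; ring_nf
    rw [le_div_iff₀ hL0, h1]
    refine hmain.trans ?_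
    have h2 : CT * (Real.exp s / L ^ 2 + (Real.exp (s / 2) / Real.log 2 + 4 * Real.exp s / (s * L))) ≤
        CT * ((C₀ + Real.sqrt C₀ / Real.log 2 + 2 * C₀) * u) := mul_le_mul_of_nonneg_left hbr hCT0
    have h3 : (34 : ℝ) ≤ 34 * u := by linarith
    rw [hK]; linarith
  -- invert `g`
  have hfin := abs_sub_dickmanXi_le hu1 hs0
  calc |s - dickmanXi u| ≤ 2 * |expSubOneDiv s - u| := hfin
    _ = 2 * |u - expSubOneDiv s| := by rw [abs_sub_comm]
    _ ≤ 2 * (K * u / L) := by linarith [hug]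
    _ = 2 * K * u / L := by ring

end Literature.NumberTheory.Sieve

end
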